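import Summits.QuantumFields.YangMills.Theorems.ParabolicTrajectoryContinuumLimitOnTrajectoryStubArp
import HarnessLib

/-!
# `ContinuumLegGivenGap` (stmt-QuantumFields-15828), line `Sketch` (reshape 17-CS): `stub_osMatching`

Support file for the crux item stmt-QuantumFields-15828
(`Summit.QuantumFields.YangMills.Theses.ConvexGribovBody.ContinuumLegGivenGap`), registered stub
`stub_osMatching` of the line `Sketch` (reshape 17-CS).

**Statement.** With `X_F(V) = ∑ₓ F(a_k x⃗) ∏ᵢ (P(τ_{xᵢ}V) − ⟨P⟩_k)` the centred lattice representative of a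
complex `n`-point test function (`P = r.curvature.F` the corner action density, `τ_x = configShift (−x)`,
`⟨P⟩_k` the torus Wilson mean; route ParabolicTrajectory's `Arp.lat sch k (fun _ => Arp.cen …) F U` is
`X_F(Ũ)`, `Ũ = torusLift (sch.side k) U`):
(i) for `F`, `H` supported at ordered positive times in `[δ, T₀]` with gaps `≥ δ`, the canonical curvature
distribution of `ΘF* ⊗ H` is the OS pairing `∫ conj X_F(Θ₀Ũ) · X_H(Ũ) dμ_k` (`Θ₀ = cfgReflect`) up to a defect of
norm `≤ a_k K`, `K` independent of `k`, granted the uniform plaquette-string inequality (UUVB) at step `k`,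
`a_k < δ`, `a_k ≤ 1`, `T₀ + a_k ≤ a_k L_k`;
(ii) likewise `‖𝓓_k(ΘF*) − conj 𝓓_k(F)‖ ≤ a_k K`.

**Proof** (route ParabolicTrajectory's landed ARP toolkit, files `…ContinuumLimitOnTrajectoryStubArp{A,B,C}`,
and the `Θ'`-invariance of Wilson's torus measure, `SpeciesTimeReflection`).
(i) `𝓓_k(ΘF* ⊗ H) = ∫ lat P̃ F̃ · lat P̃ H dμ_k` (`curvDistribution_eq_integral_lat`, `lat_append`,
`lat_osAdjoint_const`; `F̃ = conj θF`), while `conj X_F(Θ₀Ũ) = conj (lat P̃ F)(Θ'U) = lat (P̃∘Θ₀) F̃ (U)`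
(`torusLift_negReflect`, `lat_negReflect`, `conj_lat`); the difference `∫ (lat P̃ F̃ − lat (P̃∘Θ₀) F̃) · lat P̃ H` is
the finite sum of canonical plaquette-string distributions of the translated tensors `(F̃ − σ_q F̃) ⊗ H`
(`integral_defect_mul_eq_sum`, the time-chirality of the corner density), each bounded by (UUVB) at `k` on the
off-diagonal tensor (`isOffDiagonal_appendTensor_of_neg_of_pos`, `tsupport_Ftil_sub_shiftTest`) times
`|(F̃ − σ_q F̃) ⊗ H|_M ≤ 2^{M+1} · 4^M |F̃|_{M+1} a_k · |H|_M` (`schwartzNorm_appendTensor_le`,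
`schwartzNorm_compSubConstCLM_sub_le`, `norm_shiftVec_le`) — verbatim the body of `Arp.norm_defect_le`.
(ii) `𝓓_k(ΘF*) = ∫ lat P̃ F̃`, `conj 𝓓_k(F) = ∫ conj (lat P̃ F)(U) = ∫ conj (lat P̃ F)(Θ'U) = ∫ lat (P̃∘Θ₀) F̃`
(`integral_conj`, `integral_comp_negReflect_eq`), and the difference is `∑_q 𝓓^{q}_k(F̃ − σ_q F̃)`
(`lat_curvature_expand`, `lat_curvature_cfgReflect_expand`), bounded the same way.

No definitions, no facts; Mathlib + landed tree lemmas only. [folklore]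
-/

noncomputable section

namespace Summit.QuantumFields.YangMills.Theorems.ContinuumLegGivenGap

open scoped SchwartzMap ComplexConjugate
open Filter Topology MeasureTheory Literature.MathematicalPhysics.QuantumFieldTheory
  Literature.MathematicalPhysics.QuantumLattice Literature.MathematicalPhysics.AQFT
  Literature.Probability.LatticeModels
open Summit.QuantumFields.YangMills.Cruxes.ContinuumLimitOnTrajectory.TwoOrbitSynchronisation

section Helpers

variable {G : Type} [Group G] [TopologicalSpace G] [IsTopologicalGroup G] [CompactSpace G]
  [MeasurableSpace G] [BorelSpace G]

/-- A test function supported in the time slab `δ ≤ xᵢ⁰ ≤ T₀` (`δ > 0`) vanishes unless all its time coordinates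
have modulus `≤ T₀`. [folklore] -/
theorem osMatching_abs_time_le {p : ℕ} {F : 𝓢((Fin p → EuclideanSpace ℝ (Fin 4)), ℂ)} {δ T₀ : ℝ}
    (hδ : 0 < δ) (hsep : tsupport (F : (Fin p → EuclideanSpace ℝ (Fin 4)) → ℂ) ⊆
      {x | (∀ i, δ ≤ x i 0 ∧ x i 0 ≤ T₀) ∧ ∀ i i', i < i' → x i 0 + δ ≤ x i' 0}) :
    ∀ x, F x ≠ 0 → ∀ l, |x l 0| ≤ T₀ := by
  intro x hx l
  have h := (hsep (subset_tsupport _ (Function.mem_support.2 hx))).1 l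
  rw [abs_of_nonneg (hδ.le.trans h.1)]
  exact h.2

/-- Lattice functionals of centred plaquette strings are integrable for the torus Wilson measure (bounded
measurable on a probability space). [folklore] -/
theorem osMatching_integrable_lat_Vq (r : LatticeRep G) (sch : SpeciesScheme (YMSpecies G)) (k : ℕ) {p : ℕ}
    (q : Fin p → PlaqIdx) (A : 𝓢((Fin p → EuclideanSpace ℝ (Fin 4)), ℂ)) :
    Integrable (fun U => Arp.lat sch k (fun i => Arp.Vq r sch k (q i)) A U) (μW r sch k) := by
  refine Arp.integrable_of_bdd r sch k
    (Arp.measurable_lat sch k (fun i => (plaq r (q i)).measurable.sub measurable_const) A)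
    (Arp.exists_bound_lat sch k (fun i => ?_) A)
  obtain ⟨C, hC⟩ := (plaq r (q i)).bounded
  exact ⟨C + |wilsonTorusMean r.ρ (sch.β k) (sch.L k) (plaq r (q i)).F|, fun V =>
    (abs_sub _ _).trans (add_le_add (hC V) le_rfl)⟩

/-- **The pair defect is `O(a_k)`** (the body of `Arp.norm_defect_le` for one pair `(F, H)`): under the (UUVB)
inequality at step `k`, separation of the supports (`a_k < δ`, all times in `[δ, T₀]`, gaps `≥ δ`) and `a_k ≤ 1`,
`‖∑_{q,q'} 𝓓^{q⃗++q⃗'}_k((F̃ − σ_q F̃) ⊗ H)‖ ≤ a_k · K(α, β, s, n, m, F, H)`. [folklore] -/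
theorem osMatching_norm_pairDefect_le (r : LatticeRep G) (sch : SpeciesScheme (YMSpecies G)) (k : ℕ)
    {s : ℕ} {α β : ℝ} (hα : 0 ≤ α)
    (hUk : ∀ (p : ℕ) (q : Fin p → PlaqIdx) (Fx : 𝓢((Fin p → EuclideanSpace ℝ (Fin 4)), ℂ)),
      IsOffDiagonal Fx → ‖canonDistribution r sch k p (fun i => plaq r (q i)) Fx‖ ≤
        α * (p.factorial : ℝ) ^ β * schwartzNorm (p * s) Fx)
    {n m : ℕ} (F : 𝓢((Fin n → EuclideanSpace ℝ (Fin 4)), ℂ)) (H : 𝓢((Fin m → EuclideanSpace ℝ (Fin 4)), ℂ))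
    {δ T₀ : ℝ}
    (hF : tsupport (F : (Fin n → EuclideanSpace ℝ (Fin 4)) → ℂ) ⊆
      {x | (∀ i, δ ≤ x i 0 ∧ x i 0 ≤ T₀) ∧ ∀ i i', i < i' → x i 0 + δ ≤ x i' 0})
    (hH : tsupport (H : (Fin m → EuclideanSpace ℝ (Fin 4)) → ℂ) ⊆
      {x | (∀ i, δ ≤ x i 0 ∧ x i 0 ≤ T₀) ∧ ∀ i i', i < i' → x i 0 + δ ≤ x i' 0})
    (hδ : 0 < δ) (ha : sch.a k < δ) (ha1 : sch.a k ≤ 1) :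
    ‖∑ q : Fin n → PlaqIdx, ∑ q' : Fin m → PlaqIdx,
        canonDistribution r sch k (n + m) (fun i => plaq r (Fin.append q q' i))
          ((Arp.Ftil F - Arp.shiftTest sch k q (Arp.Ftil F)).appendTensor H)‖ ≤
      sch.a k * ∑ _q : Fin n → PlaqIdx, ∑ _q' : Fin m → PlaqIdx,
        α * ((n + m).factorial : ℝ) ^ β * (2 ^ ((n + m) * s + 1) *
          (4 ^ ((n + m) * s) * schwartzNorm ((n + m) * s + 1) (Arp.Ftil F)) * schwartzNorm ((n + m) * s) H) := by
  have ha0 : 0 ≤ sch.a k := (sch.a_pos k).le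
  rw [Finset.mul_sum]
  refine (norm_sum_le _ _).trans (Finset.sum_le_sum fun q _ => ?_)
  rw [Finset.mul_sum]
  refine (norm_sum_le _ _).trans (Finset.sum_le_sum fun q' _ => ?_)
  set M := (n + m) * s with hM
  set D := Arp.Ftil F - Arp.shiftTest sch k q (Arp.Ftil F) with hD
  -- off-diagonality of the translated tensor
  have hoff : IsOffDiagonal (D.appendTensor H) := by
    refine isOffDiagonal_appendTensor_of_neg_of_pos (Arp.tsupport_Ftil_sub_shiftTest sch k hF ha q)
      (hH.trans fun x hx => ⟨fun l => lt_of_lt_of_le hδ (hx.1 l).1, fun l l' hll' => ?_⟩)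
    by_contra hne
    rcases lt_or_gt_of_ne hne with hlt | hlt
    · have := hx.2 l l' hlt; linarith [hδ, hll'.le, hll'.ge]
    · have := hx.2 l' l hlt; linarith [hδ, hll'.le, hll'.ge]
  refine (hUk _ _ _ hoff).trans ?_
  -- Schwartz norms
  have h1 : schwartzNorm M (D.appendTensor H) ≤ 2 ^ (M + 1) * schwartzNorm M D * schwartzNorm M H :=
    schwartzNorm_appendTensor_le _ _ M
  have h2 : schwartzNorm M D ≤ 4 ^ M * schwartzNorm (M + 1) (Arp.Ftil F) * sch.a k := by
    have hc : ‖Arp.shiftVec (Arp.elSlots q) (sch.a k)‖ ≤ 1 := (Arp.norm_shiftVec_le _ ha0).trans ha1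
    have h := schwartzNorm_compSubConstCLM_sub_le M (Arp.Ftil F) hc
    rw [hD, ← neg_sub, show schwartzNorm M (-(Arp.shiftTest sch k q (Arp.Ftil F) - Arp.Ftil F)) =
      schwartzNorm M (Arp.shiftTest sch k q (Arp.Ftil F) - Arp.Ftil F) from map_neg_eq_map _ _]
    exact h.trans (mul_le_mul_of_nonneg_left (Arp.norm_shiftVec_le _ ha0)
      (mul_nonneg (pow_nonneg (by norm_num) _) (schwartzNorm_nonneg _ _)))
  have hF0 := schwartzNorm_nonneg M H
  have hT0 := schwartzNorm_nonneg (M + 1) (Arp.Ftil F)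
  have hfac : (0 : ℝ) ≤ α * ((n + m).factorial : ℝ) ^ β := by positivity
  calc α * ((n + m).factorial : ℝ) ^ β * schwartzNorm M (D.appendTensor H)
      ≤ α * ((n + m).factorial : ℝ) ^ β *
          (2 ^ (M + 1) * (4 ^ M * schwartzNorm (M + 1) (Arp.Ftil F) * sch.a k) * schwartzNorm M H) := by
        refine mul_le_mul_of_nonneg_left (h1.trans ?_) hfac
        gcongr
    _ = sch.a k * (α * ((n + m).factorial : ℝ) ^ β *
          (2 ^ (M + 1) * (4 ^ M * schwartzNorm (M + 1) (Arp.Ftil F)) * schwartzNorm M H)) := by ring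

/-- **The single defect is `O(a_k)`** (the `m = 0` companion of `osMatching_norm_pairDefect_le`): under the (UUVB)
inequality at step `k`, `a_k < δ` and `a_k ≤ 1`, `‖∑_q 𝓓^{q⃗}_k(F̃ − σ_q F̃)‖ ≤ a_k · K(α, β, s, n, F)` for `F`
supported at ordered positive times in `[δ, T₀]` with gaps `≥ δ`. [folklore] -/
theorem osMatching_norm_singleDefect_le (r : LatticeRep G) (sch : SpeciesScheme (YMSpecies G)) (k : ℕ)
    {s : ℕ} {α β : ℝ} (hα : 0 ≤ α)
    (hUk : ∀ (p : ℕ) (q : Fin p → PlaqIdx) (Fx : 𝓢((Fin p → EuclideanSpace ℝ (Fin 4)), ℂ)),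
      IsOffDiagonal Fx → ‖canonDistribution r sch k p (fun i => plaq r (q i)) Fx‖ ≤
        α * (p.factorial : ℝ) ^ β * schwartzNorm (p * s) Fx)
    {n : ℕ} (F : 𝓢((Fin n → EuclideanSpace ℝ (Fin 4)), ℂ)) {δ T₀ : ℝ}
    (hF : tsupport (F : (Fin n → EuclideanSpace ℝ (Fin 4)) → ℂ) ⊆
      {x | (∀ i, δ ≤ x i 0 ∧ x i 0 ≤ T₀) ∧ ∀ i i', i < i' → x i 0 + δ ≤ x i' 0})
    (ha : sch.a k < δ) (ha1 : sch.a k ≤ 1) :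
    ‖∑ q : Fin n → PlaqIdx, canonDistribution r sch k n (fun i => plaq r (q i))
        (Arp.Ftil F - Arp.shiftTest sch k q (Arp.Ftil F))‖ ≤
      sch.a k * ∑ _q : Fin n → PlaqIdx,
        α * (n.factorial : ℝ) ^ β * (4 ^ (n * s) * schwartzNorm (n * s + 1) (Arp.Ftil F)) := by
  have ha0 : 0 ≤ sch.a k := (sch.a_pos k).le
  rw [Finset.mul_sum]
  refine (norm_sum_le _ _).trans (Finset.sum_le_sum fun q _ => ?_)
  set M := n * s with hM
  set D := Arp.Ftil F - Arp.shiftTest sch k q (Arp.Ftil F) with hD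
  -- off-diagonality of the translated test function (pairwise distinct times)
  have hoff : IsOffDiagonal D :=
    IsOffDiagonal.of_tsupport_subset fun x hx hxc =>
      not_mem_coincidenceLocus_of_injective
        (fun i j hij => (Arp.tsupport_Ftil_sub_shiftTest sch k hF ha q hx).2
          (congrArg (fun y : EuclideanSpace ℝ (Fin 4) => y 0) hij)) hxc
  refine (hUk _ _ _ hoff).trans ?_
  have h2 : schwartzNorm M D ≤ 4 ^ M * schwartzNorm (M + 1) (Arp.Ftil F) * sch.a k := by
    have hc : ‖Arp.shiftVec (Arp.elSlots q) (sch.a k)‖ ≤ 1 := (Arp.norm_shiftVec_le _ ha0).trans ha1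
    have h := schwartzNorm_compSubConstCLM_sub_le M (Arp.Ftil F) hc
    rw [hD, ← neg_sub, show schwartzNorm M (-(Arp.shiftTest sch k q (Arp.Ftil F) - Arp.Ftil F)) =
      schwartzNorm M (Arp.shiftTest sch k q (Arp.Ftil F) - Arp.Ftil F) from map_neg_eq_map _ _]
    exact h.trans (mul_le_mul_of_nonneg_left (Arp.norm_shiftVec_le _ ha0)
      (mul_nonneg (pow_nonneg (by norm_num) _) (schwartzNorm_nonneg _ _)))
  have hfac : (0 : ℝ) ≤ α * (n.factorial : ℝ) ^ β := by positivity
  calc α * (n.factorial : ℝ) ^ β * schwartzNorm M D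
      ≤ α * (n.factorial : ℝ) ^ β * (4 ^ M * schwartzNorm (M + 1) (Arp.Ftil F) * sch.a k) :=
        mul_le_mul_of_nonneg_left h2 hfac
    _ = sch.a k * (α * (n.factorial : ℝ) ^ β * (4 ^ M * schwartzNorm (M + 1) (Arp.Ftil F))) := by ring

/-- **The pair identity**: `𝓓_k(ΘF* ⊗ H) − ∫ conj (lat P̃ F)(Θ'U) · (lat P̃ H)(U) dμ_k` is the pair defect
`∑_{q,q'} 𝓓^{q⃗++q⃗'}_k((F̃ − σ_q F̃) ⊗ H)`, for `F` supported at times of modulus `≤ T₀`, `T₀ + a_k ≤ a_k L_k`.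
[folklore] -/
theorem osMatching_pair_identity (r : LatticeRep G) (sch : SpeciesScheme (YMSpecies G)) (k : ℕ) {n m : ℕ}
    (F : 𝓢((Fin n → EuclideanSpace ℝ (Fin 4)), ℂ)) (H : 𝓢((Fin m → EuclideanSpace ℝ (Fin 4)), ℂ)) {T₀ : ℝ}
    (hF : ∀ x, F x ≠ 0 → ∀ l, |x l 0| ≤ T₀) (hT : T₀ + sch.a k ≤ sch.a k * sch.L k) :
    curvDistribution r sch k (n + m) ((osAdjoint F).appendTensor H) -
        ∫ U, conj (Arp.lat sch k (fun _ => Arp.cen r sch k r.curvature.F) F U.negReflect) *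
          Arp.lat sch k (fun _ => Arp.cen r sch k r.curvature.F) H U ∂(μW r sch k) =
      ∑ q : Fin n → PlaqIdx, ∑ q' : Fin m → PlaqIdx,
        canonDistribution r sch k (n + m) (fun i => plaq r (Fin.append q q' i))
          ((Arp.Ftil F - Arp.shiftTest sch k q (Arp.Ftil F)).appendTensor H) := by
  set cP := Arp.cen r sch k r.curvature.F with hcP
  have h1 : curvDistribution r sch k (n + m) ((osAdjoint F).appendTensor H) =
      ∫ U, Arp.lat sch k (fun _ => cP) (Arp.Ftil F) U * Arp.lat sch k (fun _ => cP) H U ∂(μW r sch k) := by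
    rw [Arp.curvDistribution_eq_integral_lat]
    refine integral_congr_ae (Eventually.of_forall fun U => ?_)
    dsimp only
    rw [← Arp.lat_osAdjoint_const, ← Arp.lat_append sch k (fun _ => cP) (fun _ => cP)
      (isAppendTensorOf_appendTensor _ _) U, Arp.append_const]
  have h2 : ∀ U : GaugeConfig 4 (sch.side k) G, conj (Arp.lat sch k (fun _ => cP) F U.negReflect) =
      Arp.lat sch k (fun _ V => cP (cfgReflect V)) (Arp.Ftil F) U := by
    intro U
    rw [Arp.lat_negReflect, Arp.conj_lat]
  have hI1 : Integrable (fun U => Arp.lat sch k (fun _ => cP) (Arp.Ftil F) U * Arp.lat sch k (fun _ => cP) H U)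
      (μW r sch k) := by
    have h := Arp.measurable_bdd_mul (Arp.measurable_bdd_latP r sch k (Arp.Ftil F))
      (Arp.measurable_bdd_latP r sch k H)
    exact Arp.integrable_of_bdd r sch k h.1 h.2
  have hI2 : Integrable (fun U => Arp.lat sch k (fun _ V => cP (cfgReflect V)) (Arp.Ftil F) U *
      Arp.lat sch k (fun _ => cP) H U) (μW r sch k) := by
    have h := Arp.measurable_bdd_mul (Arp.measurable_bdd_latP_refl r sch k (Arp.Ftil F))
      (Arp.measurable_bdd_latP r sch k H)
    exact Arp.integrable_of_bdd r sch k h.1 h.2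
  rw [h1]
  simp_rw [h2]
  rw [← integral_sub hI1 hI2]
  simp_rw [← sub_mul]
  exact Arp.integral_defect_mul_eq_sum r sch k (Arp.Ftil F) H (Arp.Ftil_support_bound hF) hT

/-- **The single identity**: `𝓓_k(ΘF*) − conj 𝓓_k(F) = ∑_q 𝓓^{q⃗}_k(F̃ − σ_q F̃)` for `F` supported at times of
modulus `≤ T₀`, `T₀ + a_k ≤ a_k L_k` (`Θ'`-invariance of Wilson's torus measure and the time-chirality of the
corner density). [folklore] -/
theorem osMatching_single_identity (r : LatticeRep G) (sch : SpeciesScheme (YMSpecies G)) (k : ℕ) {n : ℕ}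
    (F : 𝓢((Fin n → EuclideanSpace ℝ (Fin 4)), ℂ)) {T₀ : ℝ} (hF : ∀ x, F x ≠ 0 → ∀ l, |x l 0| ≤ T₀)
    (hT : T₀ + sch.a k ≤ sch.a k * sch.L k) :
    curvDistribution r sch k n (osAdjoint F) - conj (curvDistribution r sch k n F) =
      ∑ q : Fin n → PlaqIdx, canonDistribution r sch k n (fun i => plaq r (q i))
        (Arp.Ftil F - Arp.shiftTest sch k q (Arp.Ftil F)) := by
  set cP := Arp.cen r sch k r.curvature.F with hcP
  have h1 : curvDistribution r sch k n (osAdjoint F) =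
      ∫ U, Arp.lat sch k (fun _ => cP) (Arp.Ftil F) U ∂(μW r sch k) := by
    rw [Arp.curvDistribution_eq_integral_lat]
    exact integral_congr_ae (Eventually.of_forall fun U => Arp.lat_osAdjoint_const sch k cP F U)
  have h2 : conj (curvDistribution r sch k n F) =
      ∫ U, Arp.lat sch k (fun _ V => cP (cfgReflect V)) (Arp.Ftil F) U ∂(μW r sch k) := by
    rw [Arp.curvDistribution_eq_integral_lat, ← integral_conj,
      ← integral_comp_negReflect_eq r.ρ r.continuous (sch.β k)
        (fun U : GaugeConfig 4 (sch.side k) G => conj (Arp.lat sch k (fun _ => cP) F U))]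
    refine integral_congr_ae (Eventually.of_forall fun U => ?_)
    dsimp only
    rw [Arp.lat_negReflect, Arp.conj_lat]
  have hI1 : Integrable (fun U => Arp.lat sch k (fun _ => cP) (Arp.Ftil F) U) (μW r sch k) :=
    Arp.integrable_of_bdd r sch k (Arp.measurable_bdd_latP r sch k _).1 (Arp.measurable_bdd_latP r sch k _).2
  have hI2 : Integrable (fun U => Arp.lat sch k (fun _ V => cP (cfgReflect V)) (Arp.Ftil F) U) (μW r sch k) :=
    Arp.integrable_of_bdd r sch k (Arp.measurable_bdd_latP_refl r sch k _).1
      (Arp.measurable_bdd_latP_refl r sch k _).2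
  have hpt : ∀ U, Arp.lat sch k (fun _ => cP) (Arp.Ftil F) U -
      Arp.lat sch k (fun _ V => cP (cfgReflect V)) (Arp.Ftil F) U =
      ∑ q : Fin n → PlaqIdx, Arp.lat sch k (fun i => Arp.Vq r sch k (q i))
        (Arp.Ftil F - Arp.shiftTest sch k q (Arp.Ftil F)) U := by
    intro U
    rw [Arp.lat_curvature_expand, Arp.lat_curvature_cfgReflect_expand r sch k (Arp.Ftil F)
      (Arp.Ftil_support_bound hF) hT, ← Finset.sum_sub_distrib]
    refine Finset.sum_congr rfl fun q _ => ?_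
    rw [Arp.lat_sub]
  rw [h1, h2, ← integral_sub hI1 hI2]
  simp_rw [hpt]
  rw [integral_finsetSum _ fun q _ => osMatching_integrable_lat_Vq r sch k q _]
  exact Finset.sum_congr rfl fun q _ => (Arp.canonDistribution_eq_integral_lat r sch k n _ _).symm

/-- **Conjunct (i) in `lat` form**: `‖𝓓_k(ΘF* ⊗ H) − ∫ conj (lat P̃ F)(Θ'U) · (lat P̃ H)(U) dμ_k‖ ≤ a_k K`.
[folklore] -/
theorem osMatching_pair_bound (r : LatticeRep G) (sch : SpeciesScheme (YMSpecies G)) (k : ℕ)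
    {s : ℕ} {α β : ℝ} (hα : 0 ≤ α)
    (hUk : ∀ (p : ℕ) (q : Fin p → PlaqIdx) (Fx : 𝓢((Fin p → EuclideanSpace ℝ (Fin 4)), ℂ)),
      IsOffDiagonal Fx → ‖canonDistribution r sch k p (fun i => plaq r (q i)) Fx‖ ≤
        α * (p.factorial : ℝ) ^ β * schwartzNorm (p * s) Fx)
    {n m : ℕ} (F : 𝓢((Fin n → EuclideanSpace ℝ (Fin 4)), ℂ)) (H : 𝓢((Fin m → EuclideanSpace ℝ (Fin 4)), ℂ))
    {δ T₀ : ℝ}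
    (hF : tsupport (F : (Fin n → EuclideanSpace ℝ (Fin 4)) → ℂ) ⊆
      {x | (∀ i, δ ≤ x i 0 ∧ x i 0 ≤ T₀) ∧ ∀ i i', i < i' → x i 0 + δ ≤ x i' 0})
    (hH : tsupport (H : (Fin m → EuclideanSpace ℝ (Fin 4)) → ℂ) ⊆
      {x | (∀ i, δ ≤ x i 0 ∧ x i 0 ≤ T₀) ∧ ∀ i i', i < i' → x i 0 + δ ≤ x i' 0})
    (hδ : 0 < δ) (ha : sch.a k < δ) (ha1 : sch.a k ≤ 1) (hT : T₀ + sch.a k ≤ sch.a k * sch.L k) :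
    ‖curvDistribution r sch k (n + m) ((osAdjoint F).appendTensor H) -
        ∫ U, conj (Arp.lat sch k (fun _ => Arp.cen r sch k r.curvature.F) F U.negReflect) *
          Arp.lat sch k (fun _ => Arp.cen r sch k r.curvature.F) H U ∂(μW r sch k)‖ ≤
      sch.a k * ∑ _q : Fin n → PlaqIdx, ∑ _q' : Fin m → PlaqIdx,
        α * ((n + m).factorial : ℝ) ^ β * (2 ^ ((n + m) * s + 1) *
          (4 ^ ((n + m) * s) * schwartzNorm ((n + m) * s + 1) (Arp.Ftil F)) * schwartzNorm ((n + m) * s) H) := by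
  rw [osMatching_pair_identity r sch k F H (osMatching_abs_time_le hδ hF) hT]
  exact osMatching_norm_pairDefect_le r sch k hα hUk F H hF hH hδ ha ha1

/-- **Conjunct (ii) in `lat` form**: `‖𝓓_k(ΘF*) − conj 𝓓_k(F)‖ ≤ a_k K`. [folklore] -/
theorem osMatching_single_bound (r : LatticeRep G) (sch : SpeciesScheme (YMSpecies G)) (k : ℕ)
    {s : ℕ} {α β : ℝ} (hα : 0 ≤ α)
    (hUk : ∀ (p : ℕ) (q : Fin p → PlaqIdx) (Fx : 𝓢((Fin p → EuclideanSpace ℝ (Fin 4)), ℂ)),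
      IsOffDiagonal Fx → ‖canonDistribution r sch k p (fun i => plaq r (q i)) Fx‖ ≤
        α * (p.factorial : ℝ) ^ β * schwartzNorm (p * s) Fx)
    {n : ℕ} (F : 𝓢((Fin n → EuclideanSpace ℝ (Fin 4)), ℂ)) {δ T₀ : ℝ}
    (hF : tsupport (F : (Fin n → EuclideanSpace ℝ (Fin 4)) → ℂ) ⊆
      {x | (∀ i, δ ≤ x i 0 ∧ x i 0 ≤ T₀) ∧ ∀ i i', i < i' → x i 0 + δ ≤ x i' 0})
    (hδ : 0 < δ) (ha : sch.a k < δ) (ha1 : sch.a k ≤ 1) (hT : T₀ + sch.a k ≤ sch.a k * sch.L k) :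
    ‖curvDistribution r sch k n (osAdjoint F) - conj (curvDistribution r sch k n F)‖ ≤
      sch.a k * ∑ _q : Fin n → PlaqIdx,
        α * (n.factorial : ℝ) ^ β * (4 ^ (n * s) * schwartzNorm (n * s + 1) (Arp.Ftil F)) := by
  rw [osMatching_single_identity r sch k F (osMatching_abs_time_le hδ hF) hT]
  exact osMatching_norm_singleDefect_le r sch k hα hUk F hF ha ha1

end Helpers

/-- `stub_osMatching` — **canonical curvature distributions versus honest OS pairings of their lattice
representatives** (registered stub of stmt-QuantumFields-15828, line `Sketch`, reshape 17-CS; route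
ParabolicTrajectory's landed ARP toolkit `Arp.lat`/`cen`/`lat_append`/`lat_osAdjoint_const`/`lat_negReflect`/
`conj_lat`/`integral_defect_mul_eq_sum`/`lat_curvature_cfgReflect_expand`, `curvDistribution_eq_integral_lat`,
and the `Θ'`-invariance of Wilson's torus measure): with `X_F(V) = ∑ₓ F(a_k x⃗) ∏ᵢ (P(τ_{xᵢ}V) − ⟨P⟩_k)` the
centred lattice representative of a complex `n`-point test function (`Arp.lat … F U = X_F(Ũ)`):
(i) for `F`, `H` supported at ordered positive times in `[δ, T₀]` with gaps `≥ δ`, the canonical distribution of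
`ΘF* ⊗ H` is the OS pairing `∫ conj X_F(Θ₀Ũ) X_H(Ũ) dμ_k` up to a chirality defect `≤ a_k K` (`K` independent of
`k`), granted the (UUVB) inequality at step `k`, `a_k < δ`, `a_k ≤ 1`, `T₀ + a_k ≤ a_k L_k`; (ii) likewise
`‖𝓓_k(ΘF*) − conj 𝓓_k(F)‖ ≤ a_k K`. [folklore] -/
theorem stub_osMatching :
    ∀ (G : Type) [Group G] [TopologicalSpace G] [IsTopologicalGroup G] [CompactSpace G]
      [MeasurableSpace G] [BorelSpace G] (r : LatticeRep G) (sch : SpeciesScheme (YMSpecies G)),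
      (∀ (s : ℕ) (α β' : ℝ) (n m : ℕ) (F : SchwartzMap (Fin n → EuclideanSpace ℝ (Fin 4)) ℂ)
        (H : SchwartzMap (Fin m → EuclideanSpace ℝ (Fin 4)) ℂ) (δ T₀ : ℝ), 0 < δ → 0 ≤ α →
        tsupport (F : (Fin n → EuclideanSpace ℝ (Fin 4)) → ℂ) ⊆
        {x | (∀ i, δ ≤ x i 0 ∧ x i 0 ≤ T₀) ∧ ∀ i i', i < i' → x i 0 + δ ≤ x i' 0} →
        tsupport (H : (Fin m → EuclideanSpace ℝ (Fin 4)) → ℂ) ⊆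
        {x | (∀ i, δ ≤ x i 0 ∧ x i 0 ≤ T₀) ∧ ∀ i i', i < i' → x i 0 + δ ≤ x i' 0} →
        ∃ K : ℝ, ∀ k : ℕ,
          (∀ (p : ℕ) (q : Fin p → {q : Fin 4 × Fin 4 // q.1 < q.2})
          (Fx : SchwartzMap (Fin p → EuclideanSpace ℝ (Fin 4)) ℂ), IsOffDiagonal Fx →
          ‖∫ U : GaugeConfig 4 (sch.side k) G, ∑ x : Fin p → ↥(box 4 (sch.L k)),
              Fx (fun i => sch.a k • siteToE ↑(x i)) *
                ∏ i, ((plaquetteObs r.ρ 0 (q i).1.1 (q i).1.2 (configShift (-↑(x i)) (torusLift (sch.side k) U)) -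
                  wilsonTorusMean r.ρ (sch.β k) (sch.L k) (plaquetteObs r.ρ 0 (q i).1.1 (q i).1.2) : ℝ) : ℂ)
              ∂(wilsonMeasure r.ρ (sch.β k))‖ ≤ α * (p.factorial : ℝ) ^ β' * schwartzNorm (p * s) Fx) →
          sch.a k < δ → sch.a k ≤ 1 → T₀ + sch.a k ≤ sch.a k * sch.L k →
          ‖curvDistribution r sch k (n + m) ((osAdjoint F).appendTensor H) -
              ∫ U : GaugeConfig 4 (sch.side k) G,
                (starRingEnd ℂ) ((fun V : LGConfig 4 G => ∑ x : Fin n → ↥(box 4 (sch.L k)), F (fun i => sch.a k • siteToE (↑(x i) : Site 4)) *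
            ∏ i, ((r.curvature.F (configShift (-(↑(x i) : Site 4)) V) -
              wilsonTorusMean r.ρ (sch.β k) (sch.L k) r.curvature.F : ℝ) : ℂ))
                  (cfgReflect (torusLift (sch.side k) U))) *
                (fun V : LGConfig 4 G => ∑ x : Fin m → ↥(box 4 (sch.L k)), H (fun i => sch.a k • siteToE (↑(x i) : Site 4)) *
            ∏ i, ((r.curvature.F (configShift (-(↑(x i) : Site 4)) V) -
              wilsonTorusMean r.ρ (sch.β k) (sch.L k) r.curvature.F : ℝ) : ℂ))
                  (torusLift (sch.side k) U) ∂(wilsonMeasure r.ρ (sch.β k))‖ ≤ sch.a k * K) ∧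
      (∀ (s : ℕ) (α β' : ℝ) (n : ℕ) (F : SchwartzMap (Fin n → EuclideanSpace ℝ (Fin 4)) ℂ) (δ T₀ : ℝ),
        0 < δ → 0 ≤ α →
        tsupport (F : (Fin n → EuclideanSpace ℝ (Fin 4)) → ℂ) ⊆
        {x | (∀ i, δ ≤ x i 0 ∧ x i 0 ≤ T₀) ∧ ∀ i i', i < i' → x i 0 + δ ≤ x i' 0} →
        ∃ K : ℝ, ∀ k : ℕ,
          (∀ (p : ℕ) (q : Fin p → {q : Fin 4 × Fin 4 // q.1 < q.2})
          (Fx : SchwartzMap (Fin p → EuclideanSpace ℝ (Fin 4)) ℂ), IsOffDiagonal Fx →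
          ‖∫ U : GaugeConfig 4 (sch.side k) G, ∑ x : Fin p → ↥(box 4 (sch.L k)),
              Fx (fun i => sch.a k • siteToE ↑(x i)) *
                ∏ i, ((plaquetteObs r.ρ 0 (q i).1.1 (q i).1.2 (configShift (-↑(x i)) (torusLift (sch.side k) U)) -
                  wilsonTorusMean r.ρ (sch.β k) (sch.L k) (plaquetteObs r.ρ 0 (q i).1.1 (q i).1.2) : ℝ) : ℂ)
              ∂(wilsonMeasure r.ρ (sch.β k))‖ ≤ α * (p.factorial : ℝ) ^ β' * schwartzNorm (p * s) Fx) →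
          sch.a k < δ → sch.a k ≤ 1 → T₀ + sch.a k ≤ sch.a k * sch.L k →
          ‖curvDistribution r sch k n (osAdjoint F) - (starRingEnd ℂ) (curvDistribution r sch k n F)‖ ≤
            sch.a k * K) := by
  intro G _ _ _ _ _ _ r sch
  refine ⟨fun s α β' n m F H δ T₀ hδ hα hF hH => ⟨∑ _q : Fin n → PlaqIdx, ∑ _q' : Fin m → PlaqIdx,
      α * ((n + m).factorial : ℝ) ^ β' * (2 ^ ((n + m) * s + 1) *
        (4 ^ ((n + m) * s) * schwartzNorm ((n + m) * s + 1) (Arp.Ftil F)) * schwartzNorm ((n + m) * s) H),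
      fun k hUk ha ha1 hT => ?_⟩,
    fun s α β' n F δ T₀ hδ hα hF => ⟨∑ _q : Fin n → PlaqIdx,
      α * (n.factorial : ℝ) ^ β' * (4 ^ (n * s) * schwartzNorm (n * s + 1) (Arp.Ftil F)),
      fun k hUk ha ha1 hT => ?_⟩⟩
  · simp only [← torusLift_negReflect]
    exact osMatching_pair_bound r sch k hα (fun p q Fx hFx => hUk p q Fx hFx) F H hF hH hδ ha ha1 hT
  · exact osMatching_single_bound r sch k hα (fun p q Fx hFx => hUk p q Fx hFx) F hF hδ ha ha1 hT

end Summit.QuantumFields.YangMills.Theorems.ContinuumLegGivenGap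

end
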